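import Summits.ValiantsHypothesis.ValiantsHypothesis.Theorems.LacunarySymmetroidMatrixDescartesCensusTwoRowEdge618

/-!
# `MatrixDescartes` census — W4: THEOREM O6 for the elbow-6 edge `ZP(6..20)` in the kernel, chamber-uniform

HONEST FRAMING.  Object-search cell `pub-symmetroid`, item `DoorA26 = PosRootLawAt 2 6 19` (stmt-ValiantsHypothesis-19979,
OPEN, typed, never asserted).  Companion of `…CensusTwoRowElbowSix` (edge `6..17`, where the setting is explained) and `…TwoRowEdge618` (whose opposite-orientation tetranomial lemma is reused): the same
TWO-ROW COVARIANCE KILL (rows `a₀, a₁` against columns `c₃, c₄`, 11 Euler twists, residual tetranomial with at most one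
positive root counted with multiplicity) for the long edge `6..20` of the tropical fan of chamber 1706 — the 15-term edge form
`F = (Σ_{i ≤ 5} aᵢ X^{dᵢ})(c₃X^{d₃} + c₄X^{d₄} + c₅X^{d₅}) − (Σ_{k ∈ {3,4,5}} b_k X^{d_k})²`, `d₀ = 0` —
on EVERY exponent vector of the chamber (`d₁ < d₂ < 2d₁`, `2d₂ < d₃`, `2d₃ < d₄`, `2d₄ − d₃ < d₅`; the upper facet is not used):
`#Z₊^{mult}(F) ≤ 12 < 14 = #terms − 1`, so no hypothetical twenty on a chamber-1706 support degenerates through the face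
of elbow 6 whose long edge is `6..20` (seat note W4-E1G20 §2; engine-1 g19 TWOROW-E1G19 §3 had it support by support on the 115 box
supports).  The multiplier inequality `twoRow_multiplier_ineq_6_20` is certified by 6 grouped sub-inequalities with
non-negative slack expansions.  Nothing here bounds `ζ_sym(2,6)`, decides `DoorA26`, or bears on `MatrixDescartes`
(stmt-ValiantsHypothesis-18050) / `VP ≠ VNP`.

[folklore] Rolle with multiplicity (Euler twists) + an elementary monotonicity argument; no single source.
-/

-- `Summit.ValiantsHypothesis.ValiantsHypothesis.…` repeats a component by the D-0017 layout
-- (single-conjunct summit), which the `dupNamespace` linter flags; the name is mandated.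
set_option linter.dupNamespace false

namespace Summit.ValiantsHypothesis.ValiantsHypothesis.Theorems.LacunarySymmetroidMatrixDescartes.Census

open Polynomial Finset
open scoped BigOperators Polynomial


set_option maxHeartbeats 800000 in
-- 22-factor products on each side: the atom bookkeeping exceeds the default budget
/-- **Multiplier inequality for `ZP(6..20)`, rows `(0,1)`, columns `{3,4}`**, in the slack coordinates of chamber 1706
(`p = d₂−d₁`, `q = 2d₁−d₂`, `r = d₃−2d₂`, `s = d₄−2d₃`, `v = d₅−2d₄+d₃`): `|M₀₄|·|M₁₃| ≤ |M₀₃|·|M₁₄|` written with every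
factor a positive linear form (`ν₄ ≤ ν₃`; seat note W4-E1G20 §2). [folklore] -/
theorem twoRow_multiplier_ineq_6_20 (p q r s v : ℝ) (hp : 0 < p) (hq : 0 < q) (hr : 0 < r) (hs : 0 < s)
    (hv : 0 < v) :
    ((2 * p + q + r + s) * (s) * (2 * p + q) * (4 * p + 2 * q + r) * (4 * p + 2 * q + r + s + v) * (5 * p + 3 * q + r + s + v) * (6 * p + 3 * q + r + s + v) * (8 * p + 4 * q + 2 * r + s) * (8 * p + 4 * q + 2 * r + s + v) * (12 * p + 6 * q + 3 * r + 2 * s + v) * (16 * p + 8 * q + 4 * r + 3 * s + 2 * v))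
      * ((p) * (3 * p + q + r) * (5 * p + 2 * q + r + s) * (7 * p + 3 * q + 2 * r + s) * (7 * p + 3 * q + 2 * r + 2 * s + v) * (8 * p + 4 * q + 2 * r + 2 * s + v) * (9 * p + 4 * q + 2 * r + 2 * s + v) * (11 * p + 5 * q + 3 * r + 2 * s) * (11 * p + 5 * q + 3 * r + 2 * s + v) * (15 * p + 7 * q + 4 * r + 3 * s + v) * (19 * p + 9 * q + 5 * r + 4 * s + 2 * v))
    ≤ ((2 * p + q) * (4 * p + 2 * q + r) * (6 * p + 3 * q + r + s) * (8 * p + 4 * q + 2 * r + s) * (8 * p + 4 * q + 2 * r + 2 * s + v) * (9 * p + 5 * q + 2 * r + 2 * s + v) * (10 * p + 5 * q + 2 * r + 2 * s + v) * (12 * p + 6 * q + 3 * r + 2 * s) * (12 * p + 6 * q + 3 * r + 2 * s + v) * (16 * p + 8 * q + 4 * r + 3 * s + v) * (20 * p + 10 * q + 5 * r + 4 * s + 2 * v))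
      * ((3 * p + 2 * q + r + s) * (p + q + s) * (p) * (3 * p + q + r) * (3 * p + q + r + s + v) * (4 * p + 2 * q + r + s + v) * (5 * p + 2 * q + r + s + v) * (7 * p + 3 * q + 2 * r + s) * (7 * p + 3 * q + 2 * r + s + v) * (11 * p + 5 * q + 3 * r + 2 * s + v) * (15 * p + 7 * q + 4 * r + 3 * s + 2 * v)) := by
  have g1 : (7 * p + 3 * q + 2 * r + 2 * s + v) ≤ (9 * p + 5 * q + 2 * r + 2 * s + v) := by linarith
  have g2 : (6 * p + 3 * q + r + s + v) * (5 * p + 2 * q + r + s)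
      ≤ (6 * p + 3 * q + r + s) * (5 * p + 2 * q + r + s + v) := by
    have hd : (6 * p + 3 * q + r + s) * (5 * p + 2 * q + r + s + v)
        - (6 * p + 3 * q + r + s + v) * (5 * p + 2 * q + r + s)
        = q * v + p * v := by
      ring
    have hnn : 0 ≤ q * v + p * v := by positivity
    linarith
  have g3 : (8 * p + 4 * q + 2 * r + s + v) * (9 * p + 4 * q + 2 * r + 2 * s + v) * (11 * p + 5 * q + 3 * r + 2 * s)
      ≤ (10 * p + 5 * q + 2 * r + 2 * s + v) * (12 * p + 6 * q + 3 * r + 2 * s) * (7 * p + 3 * q + 2 * r + s + v) := by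
    have hd : (10 * p + 5 * q + 2 * r + 2 * s + v) * (12 * p + 6 * q + 3 * r + 2 * s) * (7 * p + 3 * q + 2 * r + s + v)
        - (8 * p + 4 * q + 2 * r + s + v) * (9 * p + 4 * q + 2 * r + 2 * s + v) * (11 * p + 5 * q + 3 * r + 2 * s)
        = q * v ^ 2 + 3 * q * s * v + 4 * q * r * v + 3 * q * r * s + 4 * q * r ^ 2 + 8 * q ^ 2 * v + 4 * q ^ 2 * s + 13 * q ^ 2 * r + 10 * q ^ 3 + p * v ^ 2 + 3 * p * s * v + 4 * p * r * v + 3 * p * r * s + 4 * p * r ^ 2 + 25 * p * q * v + 13 * p * q * s + 41 * p * q * r + 54 * p * q ^ 2 + 17 * p ^ 2 * v + 9 * p ^ 2 * s + 28 * p ^ 2 * r + 92 * p ^ 2 * q + 48 * p ^ 3 := by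
      ring
    have hnn : 0 ≤ q * v ^ 2 + 3 * q * s * v + 4 * q * r * v + 3 * q * r * s + 4 * q * r ^ 2 + 8 * q ^ 2 * v + 4 * q ^ 2 * s + 13 * q ^ 2 * r + 10 * q ^ 3 + p * v ^ 2 + 3 * p * s * v + 4 * p * r * v + 3 * p * r * s + 4 * p * r ^ 2 + 25 * p * q * v + 13 * p * q * s + 41 * p * q * r + 54 * p * q ^ 2 + 17 * p ^ 2 * v + 9 * p ^ 2 * s + 28 * p ^ 2 * r + 92 * p ^ 2 * q + 48 * p ^ 3 := by positivity
    linarith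
  have g4 : (16 * p + 8 * q + 4 * r + 3 * s + 2 * v) * (15 * p + 7 * q + 4 * r + 3 * s + v)
      ≤ (16 * p + 8 * q + 4 * r + 3 * s + v) * (15 * p + 7 * q + 4 * r + 3 * s + 2 * v) := by
    have hd : (16 * p + 8 * q + 4 * r + 3 * s + v) * (15 * p + 7 * q + 4 * r + 3 * s + 2 * v)
        - (16 * p + 8 * q + 4 * r + 3 * s + 2 * v) * (15 * p + 7 * q + 4 * r + 3 * s + v)
        = q * v + p * v := by
      ring
    have hnn : 0 ≤ q * v + p * v := by positivity
    linarith
  have g5 : (19 * p + 9 * q + 5 * r + 4 * s + 2 * v) ≤ (20 * p + 10 * q + 5 * r + 4 * s + 2 * v) := by linarith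
  have g6 : (5 * p + 3 * q + r + s + v) * (2 * p + q + r + s) * (s)
      ≤ (3 * p + q + r + s + v) * (3 * p + 2 * q + r + s) * (p + q + s) := by
    have hd : (3 * p + q + r + s + v) * (3 * p + 2 * q + r + s) * (p + q + s)
        - (5 * p + 3 * q + r + s + v) * (2 * p + q + r + s) * (s)
        = 2 * q * s * v + q * r * v + q * r * s + q * r ^ 2 + 2 * q ^ 2 * v + 2 * q ^ 2 * s + 3 * q ^ 2 * r + 2 * q ^ 3 + 2 * p * s * v + p * r * v + p * r * s + p * r ^ 2 + 5 * p * q * v + 7 * p * q * s + 9 * p * q * r + 11 * p * q ^ 2 + 3 * p ^ 2 * v + 5 * p ^ 2 * s + 6 * p ^ 2 * r + 18 * p ^ 2 * q + 9 * p ^ 3 := by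
      ring
    have hnn : 0 ≤ 2 * q * s * v + q * r * v + q * r * s + q * r ^ 2 + 2 * q ^ 2 * v + 2 * q ^ 2 * s + 3 * q ^ 2 * r + 2 * q ^ 3 + 2 * p * s * v + p * r * v + p * r * s + p * r ^ 2 + 5 * p * q * v + 7 * p * q * s + 9 * p * q * r + 11 * p * q ^ 2 + 3 * p ^ 2 * v + 5 * p ^ 2 * s + 6 * p ^ 2 * r + 18 * p ^ 2 * q + 9 * p ^ 3 := by positivity
    linarith
  -- turn the linear forms into atoms, then regroup (cheap `ring` on atoms) and compare group by group
  have pf0 : 0 < 2 * p + q := by positivity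
  have pf1 : 0 < 4 * p + 2 * q + r := by positivity
  have pf2 : 0 < 6 * p + 3 * q + r + s := by positivity
  have pf3 : 0 < 8 * p + 4 * q + 2 * r + s := by positivity
  have pf4 : 0 < 8 * p + 4 * q + 2 * r + 2 * s + v := by positivity
  have pf5 : 0 < 9 * p + 5 * q + 2 * r + 2 * s + v := by positivity
  have pf6 : 0 < 10 * p + 5 * q + 2 * r + 2 * s + v := by positivity
  have pf7 : 0 < 12 * p + 6 * q + 3 * r + 2 * s := by positivity
  have pf8 : 0 < 12 * p + 6 * q + 3 * r + 2 * s + v := by positivity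
  have pf9 : 0 < 16 * p + 8 * q + 4 * r + 3 * s + v := by positivity
  have pf10 : 0 < 20 * p + 10 * q + 5 * r + 4 * s + 2 * v := by positivity
  have pf11 : 0 < 2 * p + q + r + s := by positivity
  have pf12 : 0 < 4 * p + 2 * q + r + s + v := by positivity
  have pf13 : 0 < 5 * p + 3 * q + r + s + v := by positivity
  have pf14 : 0 < 6 * p + 3 * q + r + s + v := by positivity
  have pf15 : 0 < 8 * p + 4 * q + 2 * r + s + v := by positivity
  have pf16 : 0 < 16 * p + 8 * q + 4 * r + 3 * s + 2 * v := by positivity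
  have pf17 : 0 < 3 * p + q + r := by positivity
  have pf18 : 0 < 5 * p + 2 * q + r + s := by positivity
  have pf19 : 0 < 7 * p + 3 * q + 2 * r + s := by positivity
  have pf20 : 0 < 7 * p + 3 * q + 2 * r + 2 * s + v := by positivity
  have pf21 : 0 < 9 * p + 4 * q + 2 * r + 2 * s + v := by positivity
  have pf22 : 0 < 11 * p + 5 * q + 3 * r + 2 * s := by positivity
  have pf23 : 0 < 11 * p + 5 * q + 3 * r + 2 * s + v := by positivity
  have pf24 : 0 < 15 * p + 7 * q + 4 * r + 3 * s + v := by positivity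
  have pf25 : 0 < 19 * p + 9 * q + 5 * r + 4 * s + 2 * v := by positivity
  have pf26 : 0 < 3 * p + 2 * q + r + s := by positivity
  have pf27 : 0 < p + q + s := by positivity
  have pf28 : 0 < 3 * p + q + r + s + v := by positivity
  have pf29 : 0 < 5 * p + 2 * q + r + s + v := by positivity
  have pf30 : 0 < 7 * p + 3 * q + 2 * r + s + v := by positivity
  have pf31 : 0 < 15 * p + 7 * q + 4 * r + 3 * s + 2 * v := by positivity
  generalize hf10 : 20 * p + 10 * q + 5 * r + 4 * s + 2 * v = f10 at *
  generalize hf16 : 16 * p + 8 * q + 4 * r + 3 * s + 2 * v = f16 at *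
  generalize hf25 : 19 * p + 9 * q + 5 * r + 4 * s + 2 * v = f25 at *
  generalize hf31 : 15 * p + 7 * q + 4 * r + 3 * s + 2 * v = f31 at *
  generalize hf6 : 10 * p + 5 * q + 2 * r + 2 * s + v = f6 at *
  generalize hf8 : 12 * p + 6 * q + 3 * r + 2 * s + v = f8 at *
  generalize hf9 : 16 * p + 8 * q + 4 * r + 3 * s + v = f9 at *
  generalize hf23 : 11 * p + 5 * q + 3 * r + 2 * s + v = f23 at *
  generalize hf24 : 15 * p + 7 * q + 4 * r + 3 * s + v = f24 at *
  generalize hf4 : 8 * p + 4 * q + 2 * r + 2 * s + v = f4 at *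
  generalize hf5 : 9 * p + 5 * q + 2 * r + 2 * s + v = f5 at *
  generalize hf20 : 7 * p + 3 * q + 2 * r + 2 * s + v = f20 at *
  generalize hf21 : 9 * p + 4 * q + 2 * r + 2 * s + v = f21 at *
  generalize hf7 : 12 * p + 6 * q + 3 * r + 2 * s = f7 at *
  generalize hf22 : 11 * p + 5 * q + 3 * r + 2 * s = f22 at *
  generalize hf15 : 8 * p + 4 * q + 2 * r + s + v = f15 at *
  generalize hf30 : 7 * p + 3 * q + 2 * r + s + v = f30 at *
  generalize hf3 : 8 * p + 4 * q + 2 * r + s = f3 at *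
  generalize hf12 : 4 * p + 2 * q + r + s + v = f12 at *
  generalize hf13 : 5 * p + 3 * q + r + s + v = f13 at *
  generalize hf14 : 6 * p + 3 * q + r + s + v = f14 at *
  generalize hf19 : 7 * p + 3 * q + 2 * r + s = f19 at *
  generalize hf29 : 5 * p + 2 * q + r + s + v = f29 at *
  generalize hf2 : 6 * p + 3 * q + r + s = f2 at *
  generalize hf18 : 5 * p + 2 * q + r + s = f18 at *
  generalize hf26 : 3 * p + 2 * q + r + s = f26 at *
  generalize hf28 : 3 * p + q + r + s + v = f28 at *
  generalize hf1 : 4 * p + 2 * q + r = f1 at *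
  generalize hf11 : 2 * p + q + r + s = f11 at *
  generalize hf17 : 3 * p + q + r = f17 at *
  generalize hf0 : 2 * p + q = f0 at *
  generalize hf27 : p + q + s = f27 at *
  have eR : f11 * s * f0 * f1 * f12 * f13 * f14 * f3 * f15 * f8 * f16 * (p * f17 * f18 * f19 * f20 * f4 * f21 * f22 * f23 * f24 * f25)
      = (f4 * f0 * f1 * f3 * f8 * f12 * p * f17 * f19 * f23) * ((f20) * ((f14 * f18) * ((f15 * f21 * f22) * ((f16 * f24) * ((f25) * ((f13 * f11 * s))))))) := by ring
  have eL : f0 * f1 * f2 * f3 * f4 * f5 * f6 * f7 * f8 * f9 * f10 * (f26 * f27 * p * f17 * f28 * f12 * f29 * f19 * f30 * f23 * f31)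
      = (f4 * f0 * f1 * f3 * f8 * f12 * p * f17 * f19 * f23) * ((f5) * ((f2 * f29) * ((f6 * f7 * f30) * ((f9 * f31) * ((f10) * ((f28 * f26 * f27))))))) := by ring
  rw [eR, eL]
  gcongr

set_option maxHeartbeats 800000 in
-- one declaration carries the 15-term bookkeeping (sum form, 11 twists, four 11-factor multipliers): above the default budget
/-- **THEOREM O6, edge `6..20` (chamber-uniform two-row covariance kill).**  For every exponent vector of chamber 1706 and all
real coefficients with the cell's signs on the four kept terms (`a₀c₃, a₀c₄ > 0 > a₁c₃, a₁c₄`; the other letters arbitrary), the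
15-term edge form of the long edge `6..20` has at most `12 < 14 = #terms − 1` positive roots counted with multiplicity. [folklore] -/
theorem countP_posRoots_zp_6_20_le (d₁ d₂ d₃ d₄ d₅ : ℕ) (h₁ : d₁ < d₂) (h₂ : d₂ < 2 * d₁) (h₃ : 2 * d₂ < d₃)
    (h₄ : 2 * d₃ < d₄) (h₅ : 2 * d₄ < d₃ + d₅) (a₀ a₁ a₂ a₃ a₄ a₅ c₃ c₄ c₅ b₃ b₄ b₅ : ℝ) (s₀₃ : 0 < a₀ * c₃)
    (s₀₄ : 0 < a₀ * c₄) (s₁₃ : a₁ * c₃ < 0) (s₁₄ : a₁ * c₄ < 0) :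
    (((C a₀ + C a₁ * X ^ d₁ + C a₂ * X ^ d₂ + C a₃ * X ^ d₃ + C a₄ * X ^ d₄ + C a₅ * X ^ d₅) * (C c₃ * X ^ d₃ + C c₄ * X ^ d₄ + C c₅ * X ^ d₅)
        - (C b₃ * X ^ d₃ + C b₄ * X ^ d₄ + C b₅ * X ^ d₅) ^ 2 : ℝ[X]).roots.countP (fun x => 0 < x)) ≤ 12 := by
  classical
  have hg : 0 < d₄ - d₃ := by omega
  have hδ : 0 < d₁ := by omega
  have hn₁ : d₄ = d₃ + (d₄ - d₃) := by omega
  have hn₂ : d₁ + d₃ = d₃ + d₁ := by omega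
  have hn₃ : d₁ + d₄ = d₃ + (d₄ - d₃) + d₁ := by omega
  set e : ℕ → ℕ := fun t => match t with
    | 0 => d₃ | 1 => d₄ | 2 => d₁ + d₃ | 3 => d₁ + d₄ | 4 => d₂ + d₃ | 5 => 2 * d₃ | 6 => d₂ + d₄ | 7 => d₃ + d₄ | 8 => d₅ | 9 => d₁ + d₅ | 10 => d₂ + d₅ | 11 => 2 * d₄ | 12 => d₃ + d₅ | 13 => d₄ + d₅ | 14 => 2 * d₅ | _ => 0 with he
  set c : ℕ → ℝ := fun t => match t with
    | 0 => a₀ * c₃ | 1 => a₀ * c₄ | 2 => a₁ * c₃ | 3 => a₁ * c₄ | 4 => a₂ * c₃ | 5 => a₃ * c₃ - (b₃ ^ 2) | 6 => a₂ * c₄ | 7 => a₃ * c₄ + a₄ * c₃ - (b₃ * b₄ + b₃ * b₄) | 8 => a₀ * c₅ | 9 => a₁ * c₅ | 10 => a₂ * c₅ | 11 => a₄ * c₄ - (b₄ ^ 2) | 12 => a₃ * c₅ + a₅ * c₃ - (b₃ * b₅ + b₃ * b₅) | 13 => a₄ * c₅ + a₅ * c₄ - (b₄ * b₅ + b₄ *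 b₅) | 14 => a₅ * c₅ - (b₅ ^ 2) | _ => 0 with hc
  have hF : ((C a₀ + C a₁ * X ^ d₁ + C a₂ * X ^ d₂ + C a₃ * X ^ d₃ + C a₄ * X ^ d₄ + C a₅ * X ^ d₅) * (C c₃ * X ^ d₃ + C c₄ * X ^ d₄ + C c₅ * X ^ d₅)
        - (C b₃ * X ^ d₃ + C b₄ * X ^ d₄ + C b₅ * X ^ d₅) ^ 2 : ℝ[X]) = ∑ t ∈ range 15, C (c t) * X ^ (e t) := by
    simp only [Finset.sum_range_succ, Finset.sum_range_zero, zero_add, he, hc, map_mul, map_neg,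
      map_pow, map_add, pow_add, two_mul, sub_eq_add_neg]
    ring
  rw [hF]
  have step := countP_posRoots_le_countP_twists 15 e c (Ico 4 15)
  have hcard : (Ico 4 15).card = 11 := by simp
  rw [hcard] at step
  obtain ⟨M, hM⟩ : ∃ M : ℕ → ℝ, ∀ t, M t = ∏ u ∈ Ico 4 15, ((e t : ℝ) - e u) := ⟨_, fun _ => rfl⟩
  have hres : (∑ t ∈ range 15, C (c t * ∏ u ∈ Ico 4 15, ((e t : ℝ) - e u)) * X ^ (e t) : ℝ[X])
      = C (c 0 * M 0) * X ^ (e 0) + C (c 1 * M 1) * X ^ (e 1) + C (c 2 * M 2) * X ^ (e 2)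
        + C (c 3 * M 3) * X ^ (e 3) := by
    rw [Finset.range_eq_Ico, ← Finset.sum_Ico_consecutive _ (show 0 ≤ 4 by norm_num) (show 4 ≤ 15 by norm_num)]
    have hz : (∑ t ∈ Ico 4 15, C (c t * ∏ u ∈ Ico 4 15, ((e t : ℝ) - e u)) * X ^ (e t) : ℝ[X]) = 0 := by
      refine Finset.sum_eq_zero fun t ht => ?_
      rw [Finset.prod_eq_zero ht (sub_self _), mul_zero, map_zero, zero_mul]
    rw [hz, add_zero, Nat.Ico_zero_eq_range]
    simp only [Finset.sum_range_succ, Finset.sum_range_zero, zero_add, ← hM]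
  rw [hres] at step
  have e0 : e 0 = d₃ := rfl
  have e1 : e 1 = d₄ := rfl
  have e2 : e 2 = d₁ + d₃ := rfl
  have e3 : e 3 = d₁ + d₄ := rfl
  have c0 : c 0 = a₀ * c₃ := rfl
  have c1 : c 1 = a₀ * c₄ := rfl
  have c2 : c 2 = a₁ * c₃ := rfl
  have c3 : c 3 = a₁ * c₄ := rfl
  rw [e0, e1, e2, e3, c0, c1, c2, c3] at step
  have r₁ : (d₁ : ℝ) < d₂ := by exact_mod_cast h₁
  have r₂ : (d₂ : ℝ) < 2 * d₁ := by exact_mod_cast h₂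
  have r₃ : 2 * (d₂ : ℝ) < d₃ := by exact_mod_cast h₃
  have r₄ : 2 * (d₃ : ℝ) < d₄ := by exact_mod_cast h₄
  have r₅ : 2 * (d₄ : ℝ) < d₃ + d₅ := by exact_mod_cast h₅
  set p : ℝ := (d₂ : ℝ) - d₁ with hp
  set q : ℝ := 2 * (d₁ : ℝ) - d₂ with hq
  set r : ℝ := (d₃ : ℝ) - 2 * d₂ with hr
  set s : ℝ := (d₄ : ℝ) - 2 * d₃ with hs
  set v : ℝ := (d₅ : ℝ) - 2 * d₄ + d₃ with hv
  have pp : 0 < p := by rw [hp]; linarith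
  have qp : 0 < q := by rw [hq]; linarith
  have rp : 0 < r := by rw [hr]; linarith
  have sp : 0 < s := by rw [hs]; linarith
  have vp : 0 < v := by rw [hv]; linarith
  have unroll : ∀ t, M t = ((e t : ℝ) - e 4) * ((e t : ℝ) - e 5) * ((e t : ℝ) - e 6) * ((e t : ℝ) - e 7) * ((e t : ℝ) - e 8) * ((e t : ℝ) - e 9) * ((e t : ℝ) - e 10) * ((e t : ℝ) - e 11) * ((e t : ℝ) - e 12) * ((e t : ℝ) - e 13) * ((e t : ℝ) - e 14) := by
    intro t
    rw [hM, Finset.prod_Ico_eq_prod_range]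
    simp only [show (15 : ℕ) - 4 = 11 by norm_num, Finset.prod_range_succ, Finset.prod_range_zero, one_mul,
      Nat.reduceAdd]
  have e4 : e 4 = d₂ + d₃ := rfl
  have e5 : e 5 = 2 * d₃ := rfl
  have e6 : e 6 = d₂ + d₄ := rfl
  have e7 : e 7 = d₃ + d₄ := rfl
  have e8 : e 8 = d₅ := rfl
  have e9 : e 9 = d₁ + d₅ := rfl
  have e10 : e 10 = d₂ + d₅ := rfl
  have e11 : e 11 = 2 * d₄ := rfl
  have e12 : e 12 = d₃ + d₅ := rfl
  have e13 : e 13 = d₄ + d₅ := rfl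
  have e14 : e 14 = 2 * d₅ := rfl
  have hM0 : M 0 = -((2 * p + q) * (4 * p + 2 * q + r) * (6 * p + 3 * q + r + s) * (8 * p + 4 * q + 2 * r + s) * (8 * p + 4 * q + 2 * r + 2 * s + v) * (9 * p + 5 * q + 2 * r + 2 * s + v) * (10 * p + 5 * q + 2 * r + 2 * s + v) * (12 * p + 6 * q + 3 * r + 2 * s) * (12 * p + 6 * q + 3 * r + 2 * s + v) * (16 * p + 8 * q + 4 * r + 3 * s + v) * (20 * p + 10 * q + 5 * r + 4 * s + 2 * v)) := by
    rw [unroll, e0, e4, e5, e6, e7, e8, e9, e10, e11, e12, e13, e14, hp, hq, hr, hs, hv]; push_cast; ring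
  have hM1 : M 1 = -((2 * p + q + r + s) * (s) * (2 * p + q) * (4 * p + 2 * q + r) * (4 * p + 2 * q + r + s + v) * (5 * p + 3 * q + r + s + v) * (6 * p + 3 * q + r + s + v) * (8 * p + 4 * q + 2 * r + s) * (8 * p + 4 * q + 2 * r + s + v) * (12 * p + 6 * q + 3 * r + 2 * s + v) * (16 * p + 8 * q + 4 * r + 3 * s + 2 * v)) := by
    rw [unroll, e1, e4, e5, e6, e7, e8, e9, e10, e11, e12, e13, e14, hp, hq, hr, hs, hv]; push_cast; ring
  have hM2 : M 2 = -((p) * (3 * p + q + r) * (5 * p + 2 * q + r + s) * (7 * p + 3 * q + 2 * r + s) * (7 * p + 3 * q + 2 * r + 2 * s + v) * (8 * p + 4 * q + 2 * r + 2 * s + v) * (9 * p + 4 * q + 2 * r + 2 * s + v) * (11 * p + 5 * q + 3 * r + 2 * s) * (11 * p + 5 * q + 3 * r + 2 * s + v) * (15 * p + 7 * q + 4 * r + 3 * s + v) * (19 * p + 9 * q + 5 * r + 4 * s + 2 * v)) := by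
    rw [unroll, e2, e4, e5, e6, e7, e8, e9, e10, e11, e12, e13, e14, hp, hq, hr, hs, hv]; push_cast; ring
  have hM3 : M 3 = -((3 * p + 2 * q + r + s) * (p + q + s) * (p) * (3 * p + q + r) * (3 * p + q + r + s + v) * (4 * p + 2 * q + r + s + v) * (5 * p + 2 * q + r + s + v) * (7 * p + 3 * q + 2 * r + s) * (7 * p + 3 * q + 2 * r + s + v) * (11 * p + 5 * q + 3 * r + 2 * s + v) * (15 * p + 7 * q + 4 * r + 3 * s + 2 * v)) := by
    rw [unroll, e3, e4, e5, e6, e7, e8, e9, e10, e11, e12, e13, e14, hp, hq, hr, hs, hv]; push_cast; ring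
  have M0n : M 0 < 0 := by rw [hM0]; apply neg_neg_of_pos; positivity
  have M1n : M 1 < 0 := by rw [hM1]; apply neg_neg_of_pos; positivity
  have M2n : M 2 < 0 := by rw [hM2]; apply neg_neg_of_pos; positivity
  have M3n : M 3 < 0 := by rw [hM3]; apply neg_neg_of_pos; positivity
  have nM0 : -M 0 = (2 * p + q) * (4 * p + 2 * q + r) * (6 * p + 3 * q + r + s) * (8 * p + 4 * q + 2 * r + s) * (8 * p + 4 * q + 2 * r + 2 * s + v) * (9 * p + 5 * q + 2 * r + 2 * s + v) * (10 * p + 5 * q + 2 * r + 2 * s + v) * (12 * p + 6 * q + 3 * r + 2 * s) * (12 * p + 6 * q + 3 * r + 2 * s + v) * (16 * p + 8 * q + 4 * r + 3 * s + v) * (20 * p + 10 * q + 5 * r + 4 * s + 2 * v) := by rw [hM0, neg_neg]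
  have nM1 : -M 1 = (2 * p + q + r + s) * (s) * (2 * p + q) * (4 * p + 2 * q + r) * (4 * p + 2 * q + r + s + v) * (5 * p + 3 * q + r + s + v) * (6 * p + 3 * q + r + s + v) * (8 * p + 4 * q + 2 * r + s) * (8 * p + 4 * q + 2 * r + s + v) * (12 * p + 6 * q + 3 * r + 2 * s + v) * (16 * p + 8 * q + 4 * r + 3 * s + 2 * v) := by rw [hM1, neg_neg]
  have nM2 : -M 2 = (p) * (3 * p + q + r) * (5 * p + 2 * q + r + s) * (7 * p + 3 * q + 2 * r + s) * (7 * p + 3 * q + 2 * r + 2 * s + v) * (8 * p + 4 * q + 2 * r + 2 * s + v) * (9 * p + 4 * q + 2 * r + 2 * s + v) * (11 * p + 5 * q + 3 * r + 2 * s) * (11 * p + 5 * q + 3 * r + 2 * s + v) * (15 * p + 7 * q + 4 * r + 3 * s + v) * (19 * p + 9 * q + 5 * r + 4 * s + 2 * v) := by rw [hM2, neg_neg]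
  have nM3 : -M 3 = (3 * p + 2 * q + r + s) * (p + q + s) * (p) * (3 * p + q + r) * (3 * p + q + r + s + v) * (4 * p + 2 * q + r + s + v) * (5 * p + 2 * q + r + s + v) * (7 * p + 3 * q + 2 * r + s) * (7 * p + 3 * q + 2 * r + s + v) * (11 * p + 5 * q + 3 * r + 2 * s + v) * (15 * p + 7 * q + 4 * r + 3 * s + 2 * v) := by rw [hM3, neg_neg]
  have K2 : (-M 1) * (-M 2) ≤ (-M 0) * (-M 3) := by
    have K2' := twoRow_multiplier_ineq_6_20 p q r s v pp qp rp sp vp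
    rw [← nM0, ← nM1, ← nM2, ← nM3] at K2'
    exact K2'
  have hA : a₀ * c₃ * M 0 < 0 := mul_neg_of_pos_of_neg s₀₃ M0n
  have hB : a₀ * c₄ * M 1 < 0 := mul_neg_of_pos_of_neg s₀₄ M1n
  have hC : 0 < a₁ * c₃ * M 2 := mul_pos_of_neg_of_neg s₁₃ M2n
  have hD : 0 < a₁ * c₄ * M 3 := mul_pos_of_neg_of_neg s₁₄ M3n
  have hmono : -(a₀ * c₄ * M 1) * (a₁ * c₃ * M 2) ≤ -(a₀ * c₃ * M 0) * (a₁ * c₄ * M 3) := by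
    have iden : -(a₀ * c₃ * M 0) * (a₁ * c₄ * M 3) - -(a₀ * c₄ * M 1) * (a₁ * c₃ * M 2)
        = (a₀ * c₄ * -(a₁ * c₃)) * ((-M 0) * (-M 3) - (-M 1) * (-M 2)) := by ring
    have hk : 0 ≤ a₀ * c₄ * -(a₁ * c₃) := mul_nonneg s₀₄.le (neg_nonneg.2 s₁₃.le)
    rw [← sub_nonneg, iden]
    exact mul_nonneg hk (sub_nonneg.2 K2)
  have tet : ((C (a₀ * c₃ * M 0) * X ^ d₃ + C (a₀ * c₄ * M 1) * X ^ d₄ + C (a₁ * c₃ * M 2) * X ^ (d₁ + d₃)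
      + C (a₁ * c₄ * M 3) * X ^ (d₁ + d₄) : ℝ[X]).roots.countP (fun x => 0 < x)) ≤ 1 :=
    countP_posRoots_tetranomial_le_one_neg_18 _ _ _ _ hA hB hC hD hmono (g := d₄ - d₃) (δ := d₁)
      hg hδ hn₁ hn₂ hn₃
  exact step.trans (Nat.add_le_add_right tet _)

end Summit.ValiantsHypothesis.ValiantsHypothesis.Theorems.LacunarySymmetroidMatrixDescartes.Census
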